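import Summits.ResolutionOfSingularities.ResolutionOfSingularities.Theses.MaxContactCut
import Summits.ResolutionOfSingularities.ResolutionOfSingularities.Theorems.LassoCutAxisTails
import Summits.ResolutionOfSingularities.ResolutionOfSingularities.Theorems.MaxContactCutTightDefect

/-!
# MaxContactCutLassoCut — the g13 node «LassoCut» wired to the route MaxContactCut BY NAME
(decomp-res node N57, lens-5 g13 sha256 a9bc663c66df87f5; CRITIC-LEDGER row 78 CLEARED; file 4 of 4)

The node's card is the module docstring of `Theorems.LassoCutModel` (§1: `Lasso`, the PROVED pumping lemma); the pieces and the
EXACT cuts are `Theorems.LassoCutClasses` (§§2–3), the decided cell `Theorems.LassoCutAxisTails` (§4).  Route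
asides (MaxContactCut,
`aside · rank 9`): `LCNoLassos` [Σ₁ half of the model crux, certificate channel], `LCNoAperiodicWalks` [Π half,
located residual]
refining 30253 `NoForcedTowers` mod `TowerRealisation`; `LCNoDefectLassosDeep` [Σ₁, refutation channel, no port],
`LCNoAperiodicDefectWalksDeep` [Π, located residual] refining 31770 `DefectWalksDeep`.

Kernels (all by name, 0 sorry): the asides unfolded; **31770 ⟺ `LCNoDefectLassosDeep ∧
LCNoAperiodicDefectWalksDeep`** EXACT, no port
(`defectWalksDeep_iff_lasso`, `defectWalksDeep_iff_asides`); **30253 ⟹ `LCNoLassos ∧ LCNoAperiodicWalks`** mod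
`TowerRealisation`
(`halves_of_noForcedTowers`, `asides_of_noForcedTowers`) and `E 1 ⟹` both (`halves_of_e_one`); the REFUTATION CHANNELS
`not_defectWalksDeep_of_lasso` (a positive-defect lasso at `e ≥ 2` refutes 31770 outright) and
`not_noForcedTowers_of_lasso` (mod port);
the pure-head slice from the halves (`polyPureTowersDeep_of_asides`).  ROOT BY NAME is the host's
`MaxContactCutExponentLadder.closes`
(this node is an aside ladder under 30253 / 31770; the cone is unchanged — not restated).  (Sources: Hauser2010
§§F–G; HauserPerlega2019
§1; Moh1987; CossartPiltant2019 p. 4; CossartJannsenSaito2020 Cor. 5.37.)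
-/

namespace Summit.ResolutionOfSingularities.ResolutionOfSingularities.Theorems.MaxContactCutLassoCut

open MvPolynomial
open Literature.AlgebraicGeometry.Resolution
open Literature.AlgebraicGeometry.Resolution.PointBlowup
open Summit.ResolutionOfSingularities.ResolutionOfSingularities.Theses
open Summit.ResolutionOfSingularities.ResolutionOfSingularities.Theorems
open TightDefectClasses WeakOrderReduction ForcedTowerClasses LassoCut

/-! ## The cuts BY NAME (the lens §2 edges that mention the route, and §5) -/

/-- The same cut for MaxContactCut item 31770 by name. [PROVED] [folklore] -/
theorem defectWalksDeep_iff_lasso :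
    MaxContactCut.DefectWalksDeep ↔ NoDefectLassosDeep ∧ NoAperiodicDefectWalksDeep :=
  MaxContactCutTightDefect.defectWalksDeep_iff.trans defectDeep_iff_lasso

/-- Both halves are summit-side NECESSARY through the tree: `NoForcedTowers` (30253) gives them modulo the realisation
port (tree `pieces_of_noForcedTowers` pattern: `walksTerminate_of_polyPureTowers`). [PROVED mod port] [folklore] -/
theorem halves_of_noForcedTowers (hR : TowerRealisation) (h : MaxContactCut.NoForcedTowers) :
    NoLassos ∧ NoAperiodicWalks :=
  walksTerminate_iff_lasso.mp (hR (MaxContactCutTightDefect.polyPureTowersTerminate_of_noForcedTowers h))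

/-- The Σ₁ half is NECESSARY for MaxContactCut item 30253 `NoForcedTowers` modulo the realisation port. [PROVED
mod port] [folklore] -/
theorem noLassos_of_noForcedTowers (hR : TowerRealisation) (h : MaxContactCut.NoForcedTowers) : NoLassos :=
  (halves_of_noForcedTowers hR h).1

/-- **NECESSITY LEDGER from the sequence form `E 1`** (the E-side target of MaxContactCut): both halves hang under
`E 1` through the tree kernels `MaxContactCutForcedTowers.noForcedTowers_of_e_one` (counting port `TowerObstructs`) and
`halves_of_noForcedTowers` (realisation port `TowerRealisation`).  (`E 1` is by letter the SEQUENCE form, not summit-implied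
in the tree — the standing caveat of the whole E-side.) [PROVED mod ports] [folklore] -/
theorem halves_of_e_one (hT : ∀ n, 1 ≤ n → TowerObstructs n) (hR : TowerRealisation) (h : E 1) :
    NoLassos ∧ NoAperiodicWalks :=
  halves_of_noForcedTowers hR (MaxContactCutForcedTowers.noForcedTowers_of_e_one hT h)

/-- The Σ₁ half of 31770 is NECESSARY for MaxContactCut item 31770 `DefectWalksDeep` (no port). [PROVED] [folklore] -/
theorem noDefectLassosDeep_of_defectWalksDeep (h : MaxContactCut.DefectWalksDeep) : NoDefectLassosDeep :=
  noDefectLassosDeep_of_defectDeep (MaxContactCutTightDefect.defectWalksDeep_iff.mp h)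

/-- **REFUTATION CHANNEL to the host item**: a positive-defect lasso at `e ≥ 2` refutes MaxContactCut item 31770
outright (no port). [PROVED] [folklore] -/
theorem not_defectWalksDeep_of_lasso {p e : ℕ} (hp : p.Prime) (he : 2 ≤ e) {K : Type} [Field K] [CharP K p]
    [PerfectField K] [DecidableEq K] {s₀ : State (Fin 3) K} (hs : IsRoot (p ^ e) s₀) (L : Lasso (p ^ e) s₀)
    (hL : L.PosDefect) : ¬ MaxContactCut.DefectWalksDeep :=
  fun h => not_defectDeep_of_lasso hp he hs L hL (MaxContactCutTightDefect.defectWalksDeep_iff.mp h)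

/-- … and a lasso from any root refutes 30253 modulo the realisation port. [PROVED mod port] [folklore] -/
theorem not_noForcedTowers_of_lasso (hR : TowerRealisation) {p e : ℕ} (hp : p.Prime) (he : 1 ≤ e) {K : Type}
    [Field K] [CharP K p] [PerfectField K] [DecidableEq K] {s₀ : State (Fin 3) K} (hs : IsRoot (p ^ e) s₀)
    (L : Lasso (p ^ e) s₀) : ¬ MaxContactCut.NoForcedTowers :=
  fun h => not_walksTerminate_of_lasso hp he hs L (hR (MaxContactCutTightDefect.polyPureTowersTerminate_of_noForcedTowers h))
end Summit.ResolutionOfSingularities.ResolutionOfSingularities.Theorems.MaxContactCutLassoCut
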